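import Summits.CriticalPhenomena.SAWScalingLimit.Theorems.SAWLeftRightFKGLeftRightFKGDefs
import HarnessLib

/-!
# Stub `stub_endpointMonotone` of line `corner-localisation`, helper file 2: chord combinatorics

Crux `LeftRightFKG` (stmt-CriticalPhenomena-11232), vocabulary module
`Summits.CriticalPhenomena.SAWScalingLimit.Theorems.SAWLeftRightFKGLeftRightFKGDefs`.

Combinatorics of prefix/suffix classes `cls k π m σ` and step restrictions `restrP` inside one
chord type `SAW.DomainSAW Ω δ a b` (no topology, no measure):

* `lt_length_of_ne`: two DISTINCT chords of a class are longer than `k` and than `m` (a path is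
  at its endpoint only at its end);
* `filter_restrP_nextDet` / `filter_restrP_prevDet`: cutting a `restrP`-set by a next-step
  (previous-step) determined event gives again a `restrP`-set of the same class;
* `restrP_eq_succ_right` / `restrP_eq_succ_left`: a `restrP`-set all of whose chords share the
  previous (next) step is re-described with a longer suffix (prefix);
* `pot_lt_of_subset`, `pot_lt_succ_right`, `pot_lt_succ_left`: the induction potential
  `Σ_{γ ∈ Γ} ((|γ| - k) + (|γ| - m))` drops under both operations;
* `exists_splice`: SPLICING — if two chords of a `restrP`-set have a common vertex in their free
  middles, the set contains a chord with the next step of the one and the previous step of the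
  other (follow the first chord to the first such vertex, then the second);
* `lr_of_diag`: consequently, in the DIAGONAL configuration (a next-step event and a previous-step
  event coincide on the set) chords on the two sides have vertex-disjoint middles, so the
  lens-dichotomy hypothesis makes them comparable, in the direction forced by up-closedness.
-/

noncomputable section

open Finset SimpleGraph
open Literature.Probability.LatticeModels Literature.Probability.RandomPlanarGeometry
open scoped Classical

namespace Summit.CriticalPhenomena.SAWScalingLimit.Theorems.LeftRightFKG.CornerLoc

namespace EndpointMonotone

variable {Ω : Set ℂ} {δ : ℝ} {a b : Site 2}

/-! ## Distinct chords of a class are long -/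

/-- Two paths with the same endpoints which agree on positions `≤ K`, one of length `≤ K`, are
equal. [folklore] -/
theorem walk_eq_of_agree {V : Type*} {G : SimpleGraph V} {u v : V} {p q : G.Walk u v}
    (hp : p.IsPath) (hq : q.IsPath) {K : ℕ} (h : ∀ i ≤ K, p.getVert i = q.getVert i)
    (hK : p.length ≤ K) : p = q := by
  have h1 : q.length ≤ p.length := by
    by_contra hlt
    push Not at hlt
    have e := h p.length hK
    rw [Walk.getVert_length] at e
    have := (hq.getVert_eq_end_iff hlt.le).1 e.symm
    omega
  have h2 : p.length ≤ q.length := by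
    by_contra hlt
    push Not at hlt
    have e := h q.length (hlt.le.trans hK)
    rw [Walk.getVert_length] at e
    have := (hp.getVert_eq_end_iff hlt.le).1 e
    omega
  exact Walk.ext_getVert_le_length (le_antisymm h2 h1) fun i hi => h i (hi.trans hK)

/-- Chords are determined by their walks. [folklore] -/
theorem ext_walk {γ₁ γ₂ : SAW.DomainSAW Ω δ a b} (h : γ₁.walk = γ₂.walk) : γ₁ = γ₂ := by
  cases γ₁; cases γ₂; cases h; rfl

/-- KEY FACT: two distinct chords of the class `cls k π m σ` both have length `> k` and `> m`
(stated for the first; swap for the second). [folklore] -/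
theorem lt_length_of_ne {k : ℕ} {π : ℕ → Site 2} {m : ℕ} {σ : ℕ → Site 2}
    {γ₁ γ₂ : SAW.DomainSAW Ω δ a b} (h₁ : γ₁ ∈ cls k π m σ) (h₂ : γ₂ ∈ cls k π m σ)
    (hne : γ₁ ≠ γ₂) : k < γ₁.length ∧ m < γ₁.length := by
  obtain ⟨h₁a, h₁r⟩ : AgreeTo k π γ₁ ∧ AgreeToR m σ γ₁ := h₁
  obtain ⟨h₂a, h₂r⟩ : AgreeTo k π γ₂ ∧ AgreeToR m σ γ₂ := h₂
  constructor
  · by_contra hk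
    push Not at hk
    refine hne (ext_walk (walk_eq_of_agree γ₁.isPath γ₂.isPath (K := k) (fun i hi => ?_) hk))
    rw [h₁a i hi, h₂a i hi]
  · by_contra hm
    push Not at hm
    have hrev : γ₁.walk.reverse = γ₂.walk.reverse := by
      refine walk_eq_of_agree γ₁.isPath.reverse γ₂.isPath.reverse (K := m) (fun j hj => ?_) ?_
      · rw [h₁r j hj, h₂r j hj]
      · rw [Walk.length_reverse]; exact hm
    exact hne (ext_walk (by simpa using congrArg Walk.reverse hrev))

/-- The next step of a chord longer than `k` is a lattice neighbour of its vertex `k`.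
[folklore] -/
theorem getVert_succ_mem_neighborSet (γ : SAW.DomainSAW Ω δ a b) {k : ℕ} (hk : k < γ.length) :
    γ.walk.getVert (k + 1) ∈ (zdGraph 2).neighborSet (γ.walk.getVert k) := by
  rw [SimpleGraph.mem_neighborSet]
  exact meshGraph_le_zdGraph Ω δ
    (discreteDomainGraph_le_meshGraph Ω δ (γ.walk.adj_getVert_succ hk))

/-- The previous step of a chord longer than `m` is a lattice neighbour of its vertex `m` from the
end. [folklore] -/
theorem reverse_getVert_succ_mem_neighborSet (γ : SAW.DomainSAW Ω δ a b) {m : ℕ}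
    (hm : m < γ.length) :
    γ.walk.reverse.getVert (m + 1) ∈ (zdGraph 2).neighborSet (γ.walk.reverse.getVert m) := by
  rw [SimpleGraph.mem_neighborSet]
  have hm' : m < γ.walk.reverse.length := by rw [Walk.length_reverse]; exact hm
  exact meshGraph_le_zdGraph Ω δ
    (discreteDomainGraph_le_meshGraph Ω δ (γ.walk.reverse.adj_getVert_succ hm'))

/-! ## Cutting and re-describing `restrP`-sets -/

/-- Cutting `restrP k π m σ Sa Sb` by a next-step-determined event is a `restrP`-set of the same
class (smaller `Sa`). [folklore] -/
theorem filter_restrP_nextDet [Fintype (SAW.DomainSAW Ω δ a b)] {k : ℕ} {π : ℕ → Site 2} {m : ℕ}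
    {σ : ℕ → Site 2} {Sa Sb : Set (Site 2)} {A : Set (SAW.DomainSAW Ω δ a b)}
    (hA : NextDet k A) :
    (univ.filter (· ∈ restrP k π m σ Sa Sb)).filter (· ∈ A) = univ.filter
      (· ∈ restrP k π m σ (Sa ∩ {v | ∃ γ ∈ A, γ.walk.getVert (k + 1) = v}) Sb) := by
  ext γ
  simp only [Finset.mem_filter, Finset.mem_univ, true_and, restrP, Set.mem_setOf_eq,
    Set.mem_inter_iff]
  constructor
  · rintro ⟨⟨hc, ha, hb⟩, hγ⟩
    exact ⟨hc, ⟨ha, γ, hγ, rfl⟩, hb⟩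
  · rintro ⟨hc, ⟨ha, γ', hγ', he⟩, hb⟩
    exact ⟨⟨hc, ha, hb⟩, (hA γ' γ he).1 hγ'⟩

/-- Cutting `restrP k π m σ Sa Sb` by a previous-step-determined event is a `restrP`-set of the
same class (smaller `Sb`). [folklore] -/
theorem filter_restrP_prevDet [Fintype (SAW.DomainSAW Ω δ a b)] {k : ℕ} {π : ℕ → Site 2} {m : ℕ}
    {σ : ℕ → Site 2} {Sa Sb : Set (Site 2)} {B : Set (SAW.DomainSAW Ω δ a b)}
    (hB : PrevDet m B) :
    (univ.filter (· ∈ restrP k π m σ Sa Sb)).filter (· ∈ B) = univ.filter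
      (· ∈ restrP k π m σ Sa (Sb ∩ {v | ∃ γ ∈ B, γ.walk.reverse.getVert (m + 1) = v})) := by
  ext γ
  simp only [Finset.mem_filter, Finset.mem_univ, true_and, restrP, Set.mem_setOf_eq,
    Set.mem_inter_iff]
  constructor
  · rintro ⟨⟨hc, ha, hb⟩, hγ⟩
    exact ⟨hc, ha, hb, γ, hγ, rfl⟩
  · rintro ⟨hc, ha, hb, γ', hγ', he⟩
    exact ⟨⟨hc, ha, hb⟩, (hB γ' γ he).1 hγ'⟩

/-- RE-DESCRIPTION (suffix side): if all chords of `restrP k π m σ Sa Sb` share the previous step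
of `γ₀`, the set is the `restrP`-set of the longer suffix class read off `γ₀`. [folklore] -/
theorem restrP_eq_succ_right {k : ℕ} {π : ℕ → Site 2} {m : ℕ} {σ : ℕ → Site 2}
    {Sa Sb : Set (Site 2)} {γ₀ : SAW.DomainSAW Ω δ a b} (h₀ : γ₀ ∈ restrP k π m σ Sa Sb)
    (hall : ∀ γ : SAW.DomainSAW Ω δ a b, γ ∈ restrP k π m σ Sa Sb →
      γ.walk.reverse.getVert (m + 1) = γ₀.walk.reverse.getVert (m + 1)) :
    (restrP k π m σ Sa Sb : Set (SAW.DomainSAW Ω δ a b)) =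
      restrP k π (m + 1) (fun j => γ₀.walk.reverse.getVert j) Sa Set.univ := by
  ext γ
  obtain ⟨⟨-, h₀r⟩, -, h₀p⟩ := h₀
  constructor
  · intro hγ
    have hY := hall γ hγ
    obtain ⟨⟨hγa, hγr⟩, hγn, -⟩ := hγ
    refine ⟨⟨hγa, fun j hj => ?_⟩, hγn, Set.mem_univ _⟩
    rcases Nat.lt_or_ge j (m + 1) with hj' | hj'
    · exact (hγr j (Nat.lt_succ_iff.1 hj')).trans (h₀r j (Nat.lt_succ_iff.1 hj')).symm
    · rw [le_antisymm hj hj']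
      exact hY
  · rintro ⟨⟨hγa, hγr⟩, hγn, -⟩
    refine ⟨⟨hγa, fun j hj => ?_⟩, hγn, ?_⟩
    · exact (hγr j (hj.trans (Nat.le_succ m))).trans (h₀r j hj)
    · show γ.walk.reverse.getVert (m + 1) ∈ Sb
      exact (hγr (m + 1) le_rfl).symm ▸ h₀p

/-- The longer suffix class read off `γ₀ ∈ cls k π m σ` is a subclass. [folklore] -/
theorem cls_succ_right_subset {k : ℕ} {π : ℕ → Site 2} {m : ℕ} {σ : ℕ → Site 2}
    {γ₀ : SAW.DomainSAW Ω δ a b} (h₀ : γ₀ ∈ cls k π m σ) :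
    (cls k π (m + 1) (fun j => γ₀.walk.reverse.getVert j) : Set (SAW.DomainSAW Ω δ a b)) ⊆
      cls k π m σ := by
  rintro γ ⟨hγa, hγr⟩
  obtain ⟨-, h₀r⟩ := h₀
  exact ⟨hγa, fun j hj => (hγr j (hj.trans (Nat.le_succ m))).trans (h₀r j hj)⟩

/-- RE-DESCRIPTION (prefix side): if all chords of `restrP k π m σ Sa Sb` share the next step of
`γ₀`, the set is the `restrP`-set of the longer prefix class read off `γ₀`. [folklore] -/
theorem restrP_eq_succ_left {k : ℕ} {π : ℕ → Site 2} {m : ℕ} {σ : ℕ → Site 2}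
    {Sa Sb : Set (Site 2)} {γ₀ : SAW.DomainSAW Ω δ a b} (h₀ : γ₀ ∈ restrP k π m σ Sa Sb)
    (hall : ∀ γ : SAW.DomainSAW Ω δ a b, γ ∈ restrP k π m σ Sa Sb →
      γ.walk.getVert (k + 1) = γ₀.walk.getVert (k + 1)) :
    (restrP k π m σ Sa Sb : Set (SAW.DomainSAW Ω δ a b)) =
      restrP (k + 1) (fun i => γ₀.walk.getVert i) m σ Set.univ Sb := by
  ext γ
  obtain ⟨⟨h₀a, -⟩, h₀n, -⟩ := h₀
  constructor
  · intro hγ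
    have hX := hall γ hγ
    obtain ⟨⟨hγa, hγr⟩, -, hγp⟩ := hγ
    refine ⟨⟨fun i hi => ?_, hγr⟩, Set.mem_univ _, hγp⟩
    rcases Nat.lt_or_ge i (k + 1) with hi' | hi'
    · exact (hγa i (Nat.lt_succ_iff.1 hi')).trans (h₀a i (Nat.lt_succ_iff.1 hi')).symm
    · rw [le_antisymm hi hi']
      exact hX
  · rintro ⟨⟨hγa, hγr⟩, -, hγp⟩
    refine ⟨⟨fun i hi => ?_, hγr⟩, ?_, hγp⟩
    · exact (hγa i (hi.trans (Nat.le_succ k))).trans (h₀a i hi)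
    · show γ.walk.getVert (k + 1) ∈ Sa
      exact (hγa (k + 1) le_rfl).symm ▸ h₀n

/-- The longer prefix class read off `γ₀ ∈ cls k π m σ` is a subclass. [folklore] -/
theorem cls_succ_left_subset {k : ℕ} {π : ℕ → Site 2} {m : ℕ} {σ : ℕ → Site 2}
    {γ₀ : SAW.DomainSAW Ω δ a b} (h₀ : γ₀ ∈ cls k π m σ) :
    (cls (k + 1) (fun i => γ₀.walk.getVert i) m σ : Set (SAW.DomainSAW Ω δ a b)) ⊆
      cls k π m σ := by
  rintro γ ⟨hγa, hγr⟩
  obtain ⟨h₀a, -⟩ := h₀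
  exact ⟨fun i hi => (hγa i (hi.trans (Nat.le_succ k))).trans (h₀a i hi), hγr⟩

/-! ## The potential -/

/-- Removing a long chord lowers the potential. [folklore] -/
theorem pot_lt_of_subset {s t : Finset (SAW.DomainSAW Ω δ a b)} (hst : s ⊆ t)
    {γ₀ : SAW.DomainSAW Ω δ a b} (h₀ : γ₀ ∈ t) (h₀' : γ₀ ∉ s) {k m : ℕ} (hk : k < γ₀.length) :
    ∑ γ ∈ s, ((γ.length - k) + (γ.length - m)) < ∑ γ ∈ t, ((γ.length - k) + (γ.length - m)) :=
  sum_lt_sum_of_subset hst h₀ h₀' (by omega) fun _ _ _ => Nat.zero_le _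

/-- Lengthening the suffix lowers the potential. [folklore] -/
theorem pot_lt_succ_right {s : Finset (SAW.DomainSAW Ω δ a b)} (hs : s.Nonempty) {k m : ℕ}
    (hm : ∀ γ ∈ s, m < γ.length) :
    ∑ γ ∈ s, ((γ.length - k) + (γ.length - (m + 1))) <
      ∑ γ ∈ s, ((γ.length - k) + (γ.length - m)) := by
  obtain ⟨γ₀, h₀⟩ := hs
  exact sum_lt_sum (fun γ hγ => by have := hm γ hγ; omega) ⟨γ₀, h₀, by have := hm γ₀ h₀; omega⟩

/-- Lengthening the prefix lowers the potential. [folklore] -/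
theorem pot_lt_succ_left {s : Finset (SAW.DomainSAW Ω δ a b)} (hs : s.Nonempty) {k m : ℕ}
    (hk : ∀ γ ∈ s, k < γ.length) :
    ∑ γ ∈ s, ((γ.length - (k + 1)) + (γ.length - m)) <
      ∑ γ ∈ s, ((γ.length - k) + (γ.length - m)) := by
  obtain ⟨γ₀, h₀⟩ := hs
  exact sum_lt_sum (fun γ hγ => by have := hk γ hγ; omega) ⟨γ₀, h₀, by have := hk γ₀ h₀; omega⟩

/-! ## Splicing -/

/-- SPLICING. If `γ₂(i) = γ₁(j)` for middle positions `k < i < |γ₂| - m`, `k < j < |γ₁| - m` of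
two chords of `Γ = restrP k π m σ Sa Sb`, then `Γ` contains a chord with the next step of `γ₂`
and the previous step of `γ₁`: follow `γ₂` up to its FIRST middle vertex on the middle of `γ₁`,
then `γ₁`. [folklore] -/
theorem exists_splice {k : ℕ} {π : ℕ → Site 2} {m : ℕ} {σ : ℕ → Site 2} {Sa Sb : Set (Site 2)}
    {γ₁ γ₂ : SAW.DomainSAW Ω δ a b} (h₁ : γ₁ ∈ restrP k π m σ Sa Sb)
    (h₂ : γ₂ ∈ restrP k π m σ Sa Sb)
    (hx : ∃ i j : ℕ, k < i ∧ i + m < γ₂.length ∧ k < j ∧ j + m < γ₁.length ∧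
      γ₂.walk.getVert i = γ₁.walk.getVert j) :
    ∃ γ₃ : SAW.DomainSAW Ω δ a b, γ₃ ∈ restrP k π m σ Sa Sb ∧
      γ₃.walk.getVert (k + 1) = γ₂.walk.getVert (k + 1) ∧
      γ₃.walk.reverse.getVert (m + 1) = γ₁.walk.reverse.getVert (m + 1) := by
  obtain ⟨⟨h₁a, h₁r⟩, -, h₁p⟩ := h₁
  obtain ⟨⟨h₂a, h₂r⟩, h₂n, -⟩ := h₂
  have e₁ : γ₁.length = γ₁.walk.length := rfl
  have e₂ : γ₂.length = γ₂.walk.length := rfl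
  -- the first position `i` along `γ₂` of a middle-middle coincidence
  have hPr : ∃ i j : ℕ, k < i ∧ i + m < γ₂.length ∧ k < j ∧ j + m < γ₁.length ∧
      γ₂.walk.getVert i = γ₁.walk.getVert j := hx
  obtain ⟨j, hki, him, hkj, hjm, hij⟩ := Nat.find_spec hPr
  have hmin : ∀ i' < Nat.find hPr, ¬∃ j : ℕ, k < i' ∧ i' + m < γ₂.length ∧ k < j ∧
      j + m < γ₁.length ∧ γ₂.walk.getVert i' = γ₁.walk.getVert j :=
    fun i' hi' => Nat.find_min hPr hi'
  set i := Nat.find hPr with hi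
  have hiℓ : i ≤ γ₂.walk.length := by omega
  have hjℓ : j ≤ γ₁.walk.length := by omega
  -- injectivity of positions on the two paths
  have inj₁ := γ₁.isPath.getVert_injOn
  have inj₂ := γ₂.isPath.getVert_injOn
  -- the splice `γ₂[0, i] · γ₁[j, |γ₁|]`
  set p := γ₂.walk.take i with hp
  set q := (γ₁.walk.drop j).copy hij.symm rfl with hq
  have hplen : p.length = i := by rw [hp, Walk.take_length]; exact min_eq_left hiℓ
  have hqlen : q.length = γ₁.walk.length - j := by rw [hq, Walk.length_copy, Walk.drop_length]
  have hpv : ∀ n ≤ i, p.getVert n = γ₂.walk.getVert n := fun n hn => by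
    rw [hp, Walk.take_getVert, min_eq_right hn]
  have hqv : ∀ n, q.getVert n = γ₁.walk.getVert (j + n) := fun n => by
    rw [hq, Walk.getVert_copy, Walk.drop_getVert]
  have hw3v : ∀ n ≤ i, (p.append q).getVert n = γ₂.walk.getVert n := fun n hn => by
    rw [Walk.getVert_append, hplen]
    split_ifs with h
    · exact hpv n hn
    · rw [le_antisymm hn (not_lt.1 h), Nat.sub_self, Walk.getVert_zero]
  have hw3v' : ∀ n, (p.append q).getVert (i + n) = γ₁.walk.getVert (j + n) := fun n => by
    rw [Walk.getVert_append, hplen, if_neg (by omega), Nat.add_sub_cancel_left, hqv]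
  -- it is a path
  have hpath : (p.append q).IsPath := by
    rw [Walk.isPath_def, Walk.support_append, List.nodup_append]
    refine ⟨(γ₂.isPath.take i).support_nodup, ?_, fun u hu v hv huv => ?_⟩
    · have hqp : q.IsPath := by rw [hq, Walk.isPath_copy]; exact γ₁.isPath.drop j
      exact hqp.support_nodup.sublist (List.tail_sublist _)
    -- `u = γ₂(n)` with `n ≤ i`, `v = γ₁(j')` with `j < j' ≤ |γ₁|`
    rw [hp, Walk.support_take, List.mem_take_iff_getElem] at hu
    obtain ⟨n, hn, rfl⟩ := hu
    rw [Walk.length_support] at hn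
    rw [hq, Walk.support_copy, Walk.drop_support_eq_support_drop_min, min_eq_left hjℓ,
      List.tail_drop, List.mem_drop_iff_getElem] at hv
    obtain ⟨t, ht, rfl⟩ := hv
    rw [Walk.length_support] at ht
    rw [Walk.support_getElem_eq_getVert, Walk.support_getElem_eq_getVert] at huv
    have hni : n ≤ i := by omega
    rcases Nat.lt_or_ge k n with hkn | hkn
    · rcases Nat.lt_or_ge (j + 1 + t + m) γ₁.walk.length with ht' | ht'
      · -- a middle-middle coincidence at `n ≤ i`
        rcases hni.lt_or_eq with hni' | rfl
        · exact hmin n hni' ⟨j + 1 + t, hkn, by omega, by omega, by omega, huv⟩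
        · -- `n = i`: `γ₁(j) = γ₁(j + 1 + t)`
          have := inj₁ (show j ∈ {i | i ≤ γ₁.walk.length} from hjℓ)
            (show j + 1 + t ∈ {i | i ≤ γ₁.walk.length} by simp only [Set.mem_setOf_eq]; omega)
            (hij.symm.trans huv)
          omega
      · -- `v` is a suffix vertex of `γ₁`, hence of `γ₂`, at a position `> i`
        set t' := γ₁.walk.length - (j + 1 + t) with ht'def
        have ht'm : t' ≤ m := by omega
        have hv₁ : γ₁.walk.getVert (j + 1 + t) = γ₁.walk.reverse.getVert t' := by
          rw [Walk.getVert_reverse]; congr 1; omega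
        have hv₂ : γ₂.walk.reverse.getVert t' = γ₂.walk.getVert (γ₂.walk.length - t') := by
          rw [Walk.getVert_reverse]
        rw [hv₁, h₁r t' ht'm, ← h₂r t' ht'm, hv₂] at huv
        have := inj₂ (show n ∈ {i | i ≤ γ₂.walk.length} by simp only [Set.mem_setOf_eq]; omega)
          (show γ₂.walk.length - t' ∈ {i | i ≤ γ₂.walk.length} by
            simp only [Set.mem_setOf_eq]; omega) huv
        omega
    · -- `u` is a prefix vertex of `γ₂`, hence of `γ₁`, at a position `≤ k < j`
      rw [h₂a n hkn, ← h₁a n hkn] at huv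
      have := inj₁ (show n ∈ {i | i ≤ γ₁.walk.length} by simp only [Set.mem_setOf_eq]; omega)
        (show j + 1 + t ∈ {i | i ≤ γ₁.walk.length} by simp only [Set.mem_setOf_eq]; omega) huv
      omega
  -- the spliced chord
  refine ⟨⟨p.append q, hpath⟩, ⟨⟨fun n hn => ?_, fun t ht => ?_⟩, ?_, ?_⟩, ?_, ?_⟩
  · -- prefix
    rw [hw3v n (by omega), h₂a n hn]
  · -- suffix
    show (p.append q).reverse.getVert t = σ t
    rw [Walk.getVert_reverse, Walk.length_append, hplen, hqlen,
      show i + (γ₁.walk.length - j) - t = i + (γ₁.walk.length - j - t) by omega, hw3v',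
      ← h₁r t ht, Walk.getVert_reverse]
    congr 1; omega
  · show (p.append q).getVert (k + 1) ∈ Sa
    rw [hw3v (k + 1) (by omega)]
    exact h₂n
  · show (p.append q).reverse.getVert (m + 1) ∈ Sb
    rw [Walk.getVert_reverse, Walk.length_append, hplen, hqlen,
      show i + (γ₁.walk.length - j) - (m + 1) = i + (γ₁.walk.length - j - (m + 1)) by omega,
      hw3v']
    rw [Walk.getVert_reverse] at h₁p
    convert h₁p using 2; omega
  · show (p.append q).getVert (k + 1) = _
    exact hw3v (k + 1) (by omega)
  · show (p.append q).reverse.getVert (m + 1) = _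
    rw [Walk.getVert_reverse, Walk.length_append, hplen, hqlen,
      show i + (γ₁.walk.length - j) - (m + 1) = i + (γ₁.walk.length - j - (m + 1)) by omega,
      hw3v', Walk.getVert_reverse]
    congr 1; omega

/-- THE DIAGONAL CONFIGURATION. If a next-step-determined relative up-set `E` and a
previous-step-determined event `F` coincide on `Γ = restrP k π m σ Sa Sb`, then (splicing) a
chord of `Γ ∖ E` and a chord of `Γ ∩ E` have vertex-disjoint middles, so under the LENS
DICHOTOMY for the class they are comparable, and up-closedness of `E` forces `γ₁ ≼ γ₂`.
[folklore] -/
theorem lr_of_diag {k : ℕ} {π : ℕ → Site 2} {m : ℕ} {σ : ℕ → Site 2} {Sa Sb : Set (Site 2)}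
    {E F : Set (SAW.DomainSAW Ω δ a b)}
    (hD : ∀ γ₁ γ₂ : SAW.DomainSAW Ω δ a b, γ₁ ≠ γ₂ → γ₁ ∈ cls k π m σ → γ₂ ∈ cls k π m σ →
      (∀ i j : ℕ, k < i → i + m < γ₁.length → k < j → j + m < γ₂.length →
        γ₁.walk.getVert i ≠ γ₂.walk.getVert j) → lr γ₁ γ₂ ∨ lr γ₂ γ₁)
    (hE : NextDet k E) (hF : PrevDet m F) (hEup : IsUpOn (cls k π m σ) E)
    (hdiag : ∀ γ ∈ restrP k π m σ Sa Sb, (γ ∈ E ↔ γ ∈ F)) :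
    ∀ γ₁ γ₂ : SAW.DomainSAW Ω δ a b, γ₁ ∈ restrP k π m σ Sa Sb → γ₂ ∈ restrP k π m σ Sa Sb →
      γ₁ ∉ E → γ₂ ∈ E → lr γ₁ γ₂ := by
  intro γ₁ γ₂ h₁ h₂ h₁E h₂E
  have hne : γ₁ ≠ γ₂ := fun h => h₁E (h ▸ h₂E)
  have hdisj : ∀ i j : ℕ, k < i → i + m < γ₁.length → k < j → j + m < γ₂.length →
      γ₁.walk.getVert i ≠ γ₂.walk.getVert j := by
    intro i j hki him hkj hjm heq
    obtain ⟨γ₃, h₃, h₃n, h₃p⟩ := exists_splice h₁ h₂ ⟨j, i, hkj, hjm, hki, him, heq.symm⟩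
    have h₃E : γ₃ ∈ E := (hE γ₃ γ₂ h₃n).2 h₂E
    have h₃F : γ₃ ∉ F := fun h => h₁E ((hdiag γ₁ h₁).2 ((hF γ₃ γ₁ h₃p).1 h))
    exact h₃F ((hdiag γ₃ h₃).1 h₃E)
  rcases hD γ₁ γ₂ hne h₁.1 h₂.1 hdisj with h | h
  · exact h
  · exact (h₁E (hEup γ₂ γ₁ h₂.1 h₁.1 h h₂E)).elim

end EndpointMonotone

/-- REGISTERED SUB-GOAL `stub_endpointMonotoneAux2` of stub `stub_endpointMonotone` (this helper
file's key fact, recorded on the crux item so that the file lands as a `--supports` proof): two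
DISTINCT chords of a prefix/suffix class `cls k π m σ` are longer than `k` and than `m`.
[folklore] -/
theorem stub_endpointMonotoneAux2 : ∀ {Ω : Set ℂ} {δ : ℝ} {a b : Site 2} {k : ℕ} {π : ℕ → Site 2}
    {m : ℕ} {σ : ℕ → Site 2} {γ₁ γ₂ : SAW.DomainSAW Ω δ a b}, γ₁ ∈ cls k π m σ → γ₂ ∈ cls k π m σ →
    γ₁ ≠ γ₂ → k < γ₁.length ∧ m < γ₁.length :=
  EndpointMonotone.lt_length_of_ne

end Summit.CriticalPhenomena.SAWScalingLimit.Theorems.LeftRightFKG.CornerLoc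

end
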